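import Summits.Ventures.QEC.Census.LPBounds.QuantumHammingBoundAllN
import Literature.InformationTheory.QuantumCodes.QuantumHammingBoundDistanceSevenFrom80
import HarnessLib

/-!
# The quantum Hamming bound for `[[n,k,7]]` stabilizer codes: every `n ≤ 30` unconditionally, and EVERY `n` modulo the 49
# boundary LP cells `31 ≤ n ≤ 79` of item 119 (assembly half of «06.QHB7»)

Venture QEC (cell `qec`), rung X1; Summit-side assembly in the shape of item 117 (`QuantumHammingBoundAllN.lean`, whose helpers
`descend`, `bound_of_cell`, `false_of_noCode_zero`, `dist_le_of_zero` are reused). With `Q₃(n) = 1 + 3n + 9·C(n,2) + 27·C(n,3)`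
and `k₀(n) = max {k : Q₃(n)·2^k ≤ 2^n}`:

* `quantumHammingBound_seven_of_le_30 : ∀ n k, n ≤ 30 → AdditiveCodeExists n k 7 → Q₃(n)·2^k ≤ 2^n` — UNCONDITIONAL: `n ≤ 13`
  carry no distance-7 code at all (quantum Singleton for `k ≥ 1`, `NoCode.noCode_13_1` at `(13,1)`, the `k = 0` cells
  `noCode_3_0 … noCode_13_0`, the `k = 0` weight convention for `n ≤ 2`); `14 ≤ n ≤ 30` by the census's kernel LP cells at the
  boundary `(n, k₀(n)+1)`: `(14,1) (15,2) (16,3)` [stated `d ≤ 5`, used by monotonicity], `(17,3) (18,4) (19,5) (20,6) (21,6)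
  (22,7) (23,8) (24,9) (25,10) (26,10) (27,11) (28,12) (29,13) (30,14)` [stated `d ≤ 6`] + descent in `k` (CRSS Thm 6 (c)).
* `midCells` — the LIST of the 49 boundary cells `(n, k₀(n)+1)`, `31 ≤ n ≤ 79` (qec-lit-4's list, INBOX 2026-08-27T10:52:33Z,
  recomputed here): `(31,15) (32,15) (33,16) … (78,58) (79,58)`; `MidCellsNonexistence : Prop` — «no `[[n,k,7]]` additive code at
  any of them» — the 49 kernel LP-infeasibility theorems that item 119 «06.QHB7» asks of qec-type-06's engine (NOT proved here;
  this is the named hypothesis, not a weakened statement).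
* `quantumHammingBound_seven_allN_of_midCells (h : MidCellsNonexistence) : ∀ n k, AdditiveCodeExists n k 7 → Q₃(n)·2^k ≤ 2^n`
  — CONDITIONAL on those 49 cells; `n ≥ 80` is qec-lit-4's LP-free `AdditiveCodeExists.quantumHammingBound_seven` (p519705).
  When the cells land, `MidCellsNonexistence` is discharged by one `decide`-free term and the all-`n` theorem is unconditional.

Tier KERNEL for the unconditional part; the conditional theorem carries its hypothesis explicitly (gate: conditional-result).
No `native_decide`; the numeric side conditions `Q₃(n)·2^{k₀(n)} ≤ 2^n` are closed by `decide` on numerals (`n ≤ 79`).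
HONEST FRAMING: in print the `d = 7` statement rests on numerically located LP thresholds (Li–Xing 2010; Dallas–Andreadakis–Lidar
2022) — cf. qec-lit-4's register §B2; nothing here is a priority claim. [cite: Gottesman1997, Ch. 7 §7.3 (arXiv:quant-ph/9705052
chunks p0059 L1–p0060 L36)] [cite: CalderbankEtAl1998, §8 Table III (printed pp. 32–34) and §4 Thm. 6 (c) (printed p. 13)]
-/

namespace Summit.Ventures.QEC.Census.QuantumHammingBoundSevenAllN

open Literature.InformationTheory.QuantumCodes Summit.Ventures.QEC.Census.NoCode
  Summit.Ventures.QEC.Census.QuantumHammingBoundAllN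

/-- **QHB for `[[n,k,7]]`, every `n ≤ 30`, unconditionally** (small lengths by the census's kernel nonexistence cells).
(proved, KERNEL) [cite: CalderbankEtAl1998, §8 Table III (printed pp. 32–34) and §4 Thm. 6 (c) (printed p. 13)] [cite: Gottesman1997, Ch. 7 §7.3 (chunk p0060 L28–36)] -/
theorem quantumHammingBound_seven_of_le_30 :
    ∀ n k : ℕ, n ≤ 30 → AdditiveCodeExists n k 7 → (1 + 3 * n + 9 * n.choose 2 + 27 * n.choose 3) * 2 ^ k ≤ 2 ^ n := by
  intro n k hn h
  interval_cases n
  · -- `n = 0`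
    obtain rfl : k = 0 := Nat.le_zero.1 h.le
    norm_num
  · -- `n = 1`: no code
    exact (false_of_noCode_zero h (fun h' => absurd (dist_le_of_zero h' (by norm_num)) (by norm_num)) (by norm_num)).elim
  · -- `n = 2`: no code
    exact (false_of_noCode_zero h (fun h' => absurd (dist_le_of_zero h' (by norm_num)) (by norm_num)) (by norm_num)).elim
  · -- `n = 3`: cell `(3,0)`: `d ≤ 2`
    exact (false_of_noCode_zero h (fun ⟨S, hS⟩ => noCode_3_0 ⟨S, hS.mono (by norm_num)⟩) (by norm_num)).elim
  · -- `n = 4`: cell `(4,0)`: `d ≤ 2`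
    exact (false_of_noCode_zero h (fun ⟨S, hS⟩ => noCode_4_0 ⟨S, hS.mono (by norm_num)⟩) (by norm_num)).elim
  · -- `n = 5`: cell `(5,0)`: `d ≤ 3`
    exact (false_of_noCode_zero h (fun ⟨S, hS⟩ => noCode_5_0 ⟨S, hS.mono (by norm_num)⟩) (by norm_num)).elim
  · -- `n = 6`: cell `(6,0)`: `d ≤ 4`
    exact (false_of_noCode_zero h (fun ⟨S, hS⟩ => noCode_6_0 ⟨S, hS.mono (by norm_num)⟩) (by norm_num)).elim
  · -- `n = 7`: cell `(7,0)`: `d ≤ 4`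
    exact (false_of_noCode_zero h (fun ⟨S, hS⟩ => noCode_7_0 ⟨S, hS.mono (by norm_num)⟩) (by norm_num)).elim
  · -- `n = 8`: cell `(8,0)`: `d ≤ 4`
    exact (false_of_noCode_zero h (fun ⟨S, hS⟩ => noCode_8_0 ⟨S, hS.mono (by norm_num)⟩) (by norm_num)).elim
  · -- `n = 9`: cell `(9,0)`: `d ≤ 4`
    exact (false_of_noCode_zero h (fun ⟨S, hS⟩ => noCode_9_0 ⟨S, hS.mono (by norm_num)⟩) (by norm_num)).elim
  · -- `n = 10`: cell `(10,0)`: `d ≤ 4`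
    exact (false_of_noCode_zero h (fun ⟨S, hS⟩ => noCode_10_0 ⟨S, hS.mono (by norm_num)⟩) (by norm_num)).elim
  · -- `n = 11`: cell `(11,0)`: `d ≤ 5`
    exact (false_of_noCode_zero h (fun ⟨S, hS⟩ => noCode_11_0 ⟨S, hS.mono (by norm_num)⟩) (by norm_num)).elim
  · -- `n = 12`: cell `(12,0)`
    exact (false_of_noCode_zero h noCode_12_0 (by norm_num)).elim
  · -- `n = 13`: `k = 0` cell `(13,0)`, `k = 1` cell `(13,1)` (`d ≤ 5`), `k ≥ 2` quantum Singleton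
    exfalso
    rcases Nat.lt_or_ge k 2 with hk | hk
    · interval_cases k
      · exact noCode_13_0 h
      · obtain ⟨S, hS⟩ := h
        exact noCode_13_1 ⟨S, hS.mono (by norm_num)⟩
    · have := h.quantumSingleton (by omega)
      omega
  · -- `n = 14`: `k₀ = 0`, cell `(14,1)`: `d ≤ 5`
    exact bound_of_cell (K := 0) h (fun ⟨S, hS⟩ => noCode_14_1 ⟨S, hS.mono (by norm_num)⟩) (by decide)
  · -- `n = 15`: `k₀ = 1`, cell `(15,2)`: `d ≤ 5`
    exact bound_of_cell (K := 1) h (fun ⟨S, hS⟩ => noCode_15_2 ⟨S, hS.mono (by norm_num)⟩) (by decide)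
  · -- `n = 16`: `k₀ = 2`, cell `(16,3)`: `d ≤ 5`
    exact bound_of_cell (K := 2) h (fun ⟨S, hS⟩ => noCode_16_3 ⟨S, hS.mono (by norm_num)⟩) (by decide)
  · -- `n = 17`: `k₀ = 2`, cell `(17,3)`
    exact bound_of_cell (K := 2) h noCode_17_3 (by decide)
  · -- `n = 18`: `k₀ = 3`, cell `(18,4)`
    exact bound_of_cell (K := 3) h noCode_18_4 (by decide)
  · -- `n = 19`: `k₀ = 4`, cell `(19,5)`
    exact bound_of_cell (K := 4) h noCode_19_5 (by decide)
  · -- `n = 20`: `k₀ = 5`, cell `(20,6)`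
    exact bound_of_cell (K := 5) h noCode_20_6 (by decide)
  · -- `n = 21`: `k₀ = 5`, cell `(21,6)`
    exact bound_of_cell (K := 5) h noCode_21_6 (by decide)
  · -- `n = 22`: `k₀ = 6`, cell `(22,7)`
    exact bound_of_cell (K := 6) h noCode_22_7 (by decide)
  · -- `n = 23`: `k₀ = 7`, cell `(23,8)`
    exact bound_of_cell (K := 7) h noCode_23_8 (by decide)
  · -- `n = 24`: `k₀ = 8`, cell `(24,9)`
    exact bound_of_cell (K := 8) h noCode_24_9 (by decide)
  · -- `n = 25`: `k₀ = 9`, cell `(25,10)`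
    exact bound_of_cell (K := 9) h noCode_25_10 (by decide)
  · -- `n = 26`: `k₀ = 9`, cell `(26,10)`
    exact bound_of_cell (K := 9) h noCode_26_10 (by decide)
  · -- `n = 27`: `k₀ = 10`, cell `(27,11)`
    exact bound_of_cell (K := 10) h noCode_27_11 (by decide)
  · -- `n = 28`: `k₀ = 11`, cell `(28,12)`
    exact bound_of_cell (K := 11) h noCode_28_12 (by decide)
  · -- `n = 29`: `k₀ = 12`, cell `(29,13)`
    exact bound_of_cell (K := 12) h noCode_29_13 (by decide)
  · -- `n = 30`: `k₀ = 13`, cell `(30,14)`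
    exact bound_of_cell (K := 13) h noCode_30_14 (by decide)

/-- The 49 boundary cells `(n, k₀(n)+1)`, `31 ≤ n ≤ 79`, of the `d = 7` quantum Hamming bound (item 119 «06.QHB7»; qec-lit-4's list).
(definition) [cite: Gottesman1997, Ch. 7 §7.3 (chunk p0060 L28–36: the d = 7 bound)] -/
def midCells : List (ℕ × ℕ) :=
  [(31, 15), (32, 15), (33, 16), (34, 17), (35, 18), (36, 19), (37, 20), (38, 21), (39, 22), (40, 22), (41, 23), (42, 24), (43, 25), (44, 26), (45, 27), (46, 28), (47, 29), (48, 30), (49, 31), (50, 31), (51, 32), (52, 33), (53, 34), (54, 35), (55, 36), (56, 37), (57, 38), (58, 39), (59, 40), (60, 41), (61, 42), (62, 43), (63, 43), (64, 44), (65, 45), (66, 46), (67, 47), (68, 48), (69, 49), (70, 50), (71, 51), (72, 52), (73, 53), (74, 54), (75, 55), (76, 56), (77, 57), (78, 58), (79, 58)]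

/-- **The named hypothesis of item 119**: at each of the 49 boundary cells NO `[[n,k,7]]` additive code exists (to be discharged
by kernel LP-infeasibility certificates, qec-type-06's engine). NOT proved here. (definition)
[cite: CalderbankEtAl1998, §7 Thm. 21 (printed p. 26: the LP bound) and §4 Thm. 6 (e)] -/
def MidCellsNonexistence : Prop := ∀ c ∈ midCells, ¬ AdditiveCodeExists c.1 c.2 7

/-- **QHB for `[[n,k,7]]` at EVERY `n`, CONDITIONAL on the 49 mid cells**: `n ≤ 30` unconditional (above), `31 ≤ n ≤ 79` by the
hypothesis cells + descent in `k`, `n ≥ 80` by qec-lit-4's LP-free counting theorem `AdditiveCodeExists.quantumHammingBound_seven`.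
(proved modulo `MidCellsNonexistence`) [cite: Gottesman1997, Ch. 7 §7.3 (chunks p0059 L1–p0060 L36)] [cite: CalderbankEtAl1998, §4 Thm. 6 (c) (printed p. 13)] -/
theorem quantumHammingBound_seven_allN_of_midCells (hmid : MidCellsNonexistence) :
    ∀ n k : ℕ, AdditiveCodeExists n k 7 → (1 + 3 * n + 9 * n.choose 2 + 27 * n.choose 3) * 2 ^ k ≤ 2 ^ n := by
  intro n k h
  rcases Nat.lt_or_ge n 31 with h30 | h31
  · exact quantumHammingBound_seven_of_le_30 n k (by omega) h
  rcases Nat.lt_or_ge n 80 with h79 | h80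
  swap
  · exact h.quantumHammingBound_seven h80
  interval_cases n
  · exact bound_of_cell (K := 14) h (hmid (31, 15) (by decide)) (by decide)
  · exact bound_of_cell (K := 14) h (hmid (32, 15) (by decide)) (by decide)
  · exact bound_of_cell (K := 15) h (hmid (33, 16) (by decide)) (by decide)
  · exact bound_of_cell (K := 16) h (hmid (34, 17) (by decide)) (by decide)
  · exact bound_of_cell (K := 17) h (hmid (35, 18) (by decide)) (by decide)
  · exact bound_of_cell (K := 18) h (hmid (36, 19) (by decide)) (by decide)
  · exact bound_of_cell (K := 19) h (hmid (37, 20) (by decide)) (by decide)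
  · exact bound_of_cell (K := 20) h (hmid (38, 21) (by decide)) (by decide)
  · exact bound_of_cell (K := 21) h (hmid (39, 22) (by decide)) (by decide)
  · exact bound_of_cell (K := 21) h (hmid (40, 22) (by decide)) (by decide)
  · exact bound_of_cell (K := 22) h (hmid (41, 23) (by decide)) (by decide)
  · exact bound_of_cell (K := 23) h (hmid (42, 24) (by decide)) (by decide)
  · exact bound_of_cell (K := 24) h (hmid (43, 25) (by decide)) (by decide)
  · exact bound_of_cell (K := 25) h (hmid (44, 26) (by decide)) (by decide)
  · exact bound_of_cell (K := 26) h (hmid (45, 27) (by decide)) (by decide)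
  · exact bound_of_cell (K := 27) h (hmid (46, 28) (by decide)) (by decide)
  · exact bound_of_cell (K := 28) h (hmid (47, 29) (by decide)) (by decide)
  · exact bound_of_cell (K := 29) h (hmid (48, 30) (by decide)) (by decide)
  · exact bound_of_cell (K := 30) h (hmid (49, 31) (by decide)) (by decide)
  · exact bound_of_cell (K := 30) h (hmid (50, 31) (by decide)) (by decide)
  · exact bound_of_cell (K := 31) h (hmid (51, 32) (by decide)) (by decide)
  · exact bound_of_cell (K := 32) h (hmid (52, 33) (by decide)) (by decide)
  · exact bound_of_cell (K := 33) h (hmid (53, 34) (by decide)) (by decide)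
  · exact bound_of_cell (K := 34) h (hmid (54, 35) (by decide)) (by decide)
  · exact bound_of_cell (K := 35) h (hmid (55, 36) (by decide)) (by decide)
  · exact bound_of_cell (K := 36) h (hmid (56, 37) (by decide)) (by decide)
  · exact bound_of_cell (K := 37) h (hmid (57, 38) (by decide)) (by decide)
  · exact bound_of_cell (K := 38) h (hmid (58, 39) (by decide)) (by decide)
  · exact bound_of_cell (K := 39) h (hmid (59, 40) (by decide)) (by decide)
  · exact bound_of_cell (K := 40) h (hmid (60, 41) (by decide)) (by decide)
  · exact bound_of_cell (K := 41) h (hmid (61, 42) (by decide)) (by decide)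
  · exact bound_of_cell (K := 42) h (hmid (62, 43) (by decide)) (by decide)
  · exact bound_of_cell (K := 42) h (hmid (63, 43) (by decide)) (by decide)
  · exact bound_of_cell (K := 43) h (hmid (64, 44) (by decide)) (by decide)
  · exact bound_of_cell (K := 44) h (hmid (65, 45) (by decide)) (by decide)
  · exact bound_of_cell (K := 45) h (hmid (66, 46) (by decide)) (by decide)
  · exact bound_of_cell (K := 46) h (hmid (67, 47) (by decide)) (by decide)
  · exact bound_of_cell (K := 47) h (hmid (68, 48) (by decide)) (by decide)
  · exact bound_of_cell (K := 48) h (hmid (69, 49) (by decide)) (by decide)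
  · exact bound_of_cell (K := 49) h (hmid (70, 50) (by decide)) (by decide)
  · exact bound_of_cell (K := 50) h (hmid (71, 51) (by decide)) (by decide)
  · exact bound_of_cell (K := 51) h (hmid (72, 52) (by decide)) (by decide)
  · exact bound_of_cell (K := 52) h (hmid (73, 53) (by decide)) (by decide)
  · exact bound_of_cell (K := 53) h (hmid (74, 54) (by decide)) (by decide)
  · exact bound_of_cell (K := 54) h (hmid (75, 55) (by decide)) (by decide)
  · exact bound_of_cell (K := 55) h (hmid (76, 56) (by decide)) (by decide)
  · exact bound_of_cell (K := 56) h (hmid (77, 57) (by decide)) (by decide)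
  · exact bound_of_cell (K := 57) h (hmid (78, 58) (by decide)) (by decide)
  · exact bound_of_cell (K := 57) h (hmid (79, 58) (by decide)) (by decide)

/-- Monotone form of the conditional theorem: every `[[n,k,d]]` with `d ≥ 7` obeys the `t = 3` bound, given the mid cells.
(proved modulo `MidCellsNonexistence`) [cite: Gottesman1997, Ch. 7 §7.3 (chunk p0060 L28–36)] -/
theorem quantumHammingBound_three_of_seven_le_of_midCells (hmid : MidCellsNonexistence) {n k d : ℕ} (hd : 7 ≤ d)
    (h : AdditiveCodeExists n k d) : (1 + 3 * n + 9 * n.choose 2 + 27 * n.choose 3) * 2 ^ k ≤ 2 ^ n := by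
  obtain ⟨S, hS⟩ := h
  exact quantumHammingBound_seven_allN_of_midCells hmid n k ⟨S, hS.mono hd⟩

end Summit.Ventures.QEC.Census.QuantumHammingBoundSevenAllN
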